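import Mathlib
import Summits.ValiantsHypothesis.ValiantsHypothesis.Theorems.LacunarySymmetroidMatrixDescartesCensusWindowFourPocketKey
import Summits.ValiantsHypothesis.ValiantsHypothesis.Theorems.LacunarySymmetroidMatrixDescartesCensusWindowFourPocketBranch

/-!
# `MatrixDescartes` census — WINDOW-4 POCKET ROWS IV: the four monotone POCKET ROWS of the alternating window 4-nomial

HONEST FRAMING.  Object-search cell `pub-symmetroid`, door-A target `DoorA26 := PosRootLawAt 2 6 19`
(stmt-ValiantsHypothesis-19979; OPEN, typed, never asserted).  Necessary-condition rows about the four-term WINDOWS of HYPOTHETICAL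
Descartes-sharp fewnomials; nothing here bounds any census count, kills any cell or bears on `MatrixDescartes`
(stmt-ValiantsHypothesis-18050) / `VP ≠ VNP`.

The kernel form of the window-4 «pocket row» (engine-2 g34 memo `W4-COVERAGE-E2G34.md` §3 KERNEL GAP; desk R3098 (ii)) = the four
monotone bound transfers of the exact-tube instrument `exacttubeq.py` (`lower/upper_bound_partner` on the branches `'lo'` / `'up'`),
for `g = a − bX^u + cX^(u+v) − eX^(u+v+w)` (`u,v,w ≥ 1`, `a,b,c,e > 0`) with ≥ 3 positive roots COUNTED WITH MULTIPLICITY and a branch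
parameter `t > 0` (for the normal form's rational double root `ρ`: `t = ρ^S`; every constant below is a polynomial in `t` with natural
coefficients, so a replay checks the hypotheses by rational arithmetic):

* lower branch `w(v+w)t ≤ u(u+v)`:  `Σ2 ≥ H2(t) ⇒ Σ1 ≥ H1(t)` (`fourNomial_pocket_lower_of_three_le_countP`) and
  `Σ1 ≤ H1(t) ⇒ Σ2 ≤ H2(t)` (`…_lower_…'`);
* upper branch `u(u+v) ≤ w(v+w)t`:  `Σ1 ≥ H1(t) ⇒ Σ2 ≥ H2(t)` (`fourNomial_pocket_upper_of_three_le_countP`) and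
  `Σ2 ≤ H2(t) ⇒ Σ1 ≤ H1(t)` (`…_upper_…'`),

with `Σ1 = b^(u+v)/(a^v c^u)`, `Σ2 = c^(v+w)/(b^w e^v)`, `H1(t) = ((u+v)+wt)^(u+v)/(v^v (u+(v+w)t)^u)`,
`H2(t) = (u+(v+w)t)^(v+w)/(v^v ((u+v)+wt)^w t^v)`, all written as product inequalities.  Mechanism (`fourNomial_lower/upper_branch_bounds`):
at the lower critical point `y₁` of `g/X^u` (file II) with `t₁ = e y₁^S/a ≤ t*` one has `Σ1 ≥ H1(t₁)`, `Σ2 ≤ H2(t₁)` EXACTLY by the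
identities `v c y₁^(u+v) = a(u+(v+w)t₁)`, `v b y₁^u ≥ a((u+v)+w t₁)`; then the strict monotonicity of file III moves `t₁` to `t`.
A weaker given bound (`Σ2 ≥ M ≥ H2(t)`) or a weaker conclusion (`H1(t) ≥ F`) is composed by the consumer.  NOT here: the secant
(«xt-sec», concavity) rows and the `_of_sharp` / log-table layers — separate files.

[folklore] Elementary; no single source (the «horn pocket» picture is engine-2 g34's located memo).
-/

-- `Summit.ValiantsHypothesis.ValiantsHypothesis.…` repeats a component by the D-0017 layout
-- (single-conjunct summit), which the `dupNamespace` linter flags; the name is mandated.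
set_option linter.dupNamespace false

namespace Summit.ValiantsHypothesis.ValiantsHypothesis.Theorems.LacunarySymmetroidMatrixDescartes.Census

open Polynomial Finset Set
open scoped BigOperators Polynomial

/-! ## The branch bounds at the critical points, and the four POCKET ROWS -/

/-- **Lower-branch bounds.**  If the window 4-nomial (`a, b, c, e > 0`) has three positive roots with multiplicity, there is a
lower-branch parameter `0 < t₁ ≤ t*` (`t₁ = e·y₁^S/a` at the lower critical point `y₁` of `g/X^u`) with
`Σ1 ≥ H1(t₁)` and `Σ2 ≤ H2(t₁)`, written as product inequalities. [folklore] -/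
theorem fourNomial_lower_branch_bounds {u v w : ℕ} (hu : 0 < u) (hv : 0 < v) (hw : 0 < w)
    {a b c e : ℝ} (ha : 0 < a) (hc : 0 < c) (he : 0 < e)
    (h3 : 3 ≤ (C a - C b * X ^ u + C c * X ^ (u + v) - C e * X ^ (u + v + w) : ℝ[X]).roots.countP (fun x => 0 < x)) :
    ∃ t₁ : ℝ, 0 < t₁ ∧ (w : ℝ) * ((v : ℝ) + w) * t₁ ≤ (u : ℝ) * ((u : ℝ) + v) ∧
      a ^ v * c ^ u * (((u : ℝ) + v) + (w : ℝ) * t₁) ^ (u + v)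
        ≤ b ^ (u + v) * (v : ℝ) ^ v * ((u : ℝ) + ((v : ℝ) + w) * t₁) ^ u ∧
      c ^ (v + w) * (v : ℝ) ^ v * ((((u : ℝ) + v) + (w : ℝ) * t₁) ^ w * t₁ ^ v)
        ≤ b ^ w * e ^ v * ((u : ℝ) + ((v : ℝ) + w) * t₁) ^ (v + w) := by
  obtain ⟨y₁, y₂, hy₁, -, hΦ₁, -, hg₁, -, hc₁, -⟩ :=
    fourNomial_exists_twist_zeros_of_three_le_countP hu hv hw ha hc he (b := b) h3
  set t₁ : ℝ := e * y₁ ^ (u + v + w) / a with ht₁def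
  have ht₁ : a * t₁ = e * y₁ ^ (u + v + w) := by rw [ht₁def]; field_simp
  have ht₁0 : 0 < t₁ := by rw [ht₁def]; positivity
  -- (R1) `v c y₁^(u+v) = a·B`, (R2) `a·A ≤ v b y₁^u`
  have hR1 : (v : ℝ) * c * y₁ ^ (u + v) = a * ((u : ℝ) + ((v : ℝ) + w) * t₁) := by
    linear_combination (-1 : ℝ) * hΦ₁ - ((v : ℝ) + w) * ht₁
  have hR2 : a * (((u : ℝ) + v) + (w : ℝ) * t₁) ≤ (v : ℝ) * b * y₁ ^ u := by
    linear_combination (v : ℝ) * hg₁ - hR1 - (v : ℝ) * ht₁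
  set A : ℝ := ((u : ℝ) + v) + (w : ℝ) * t₁ with hA
  set B : ℝ := (u : ℝ) + ((v : ℝ) + w) * t₁ with hB
  have hA0 : 0 < A := by rw [hA]; positivity
  have hB0 : 0 < B := by rw [hB]; positivity
  have haA : 0 ≤ a * A := by positivity
  refine ⟨t₁, ht₁0, ?_, ?_, ?_⟩
  · rw [ht₁def, ← mul_div_assoc, div_le_iff₀ ha]; linarith
  · -- Σ1 ≥ H1(t₁): multiply by K = v^u (y₁^(u+v))^u
    have hK : 0 < (v : ℝ) ^ u * (y₁ ^ (u + v)) ^ u := by positivity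
    have hsw : (y₁ ^ (u + v)) ^ u = (y₁ ^ u) ^ (u + v) := by rw [← pow_mul, ← pow_mul, mul_comm]
    have h1 : (a * A) ^ (u + v) ≤ ((v : ℝ) * b * y₁ ^ u) ^ (u + v) := pow_le_pow_left₀ haA hR2 _
    have key : a ^ v * c ^ u * A ^ (u + v) * ((v : ℝ) ^ u * (y₁ ^ (u + v)) ^ u)
        ≤ b ^ (u + v) * (v : ℝ) ^ v * B ^ u * ((v : ℝ) ^ u * (y₁ ^ (u + v)) ^ u) := by
      calc a ^ v * c ^ u * A ^ (u + v) * ((v : ℝ) ^ u * (y₁ ^ (u + v)) ^ u)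
          = a ^ v * A ^ (u + v) * ((v : ℝ) * c * y₁ ^ (u + v)) ^ u := by ring
        _ = (a * A) ^ (u + v) * B ^ u := by rw [hR1]; ring
        _ ≤ ((v : ℝ) * b * y₁ ^ u) ^ (u + v) * B ^ u := mul_le_mul_of_nonneg_right h1 (pow_pos hB0 u).le
        _ = b ^ (u + v) * (v : ℝ) ^ v * B ^ u * ((v : ℝ) ^ u * (y₁ ^ (u + v)) ^ u) := by rw [hsw]; ring
    exact le_of_mul_le_mul_right key hK
  · -- Σ2 ≤ H2(t₁): multiply by K = v^w (y₁^(u+v))^(v+w)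
    have hK : 0 < (v : ℝ) ^ w * (y₁ ^ (u + v)) ^ (v + w) := by positivity
    have hsw : (y₁ ^ (u + v)) ^ (v + w) = (y₁ ^ u) ^ w * (y₁ ^ (u + v + w)) ^ v := by
      rw [← pow_mul, ← pow_mul, ← pow_mul, ← pow_add]; congr 1; ring
    have h1 : (a * A) ^ w ≤ ((v : ℝ) * b * y₁ ^ u) ^ w := pow_le_pow_left₀ haA hR2 _
    have key : c ^ (v + w) * (v : ℝ) ^ v * (A ^ w * t₁ ^ v) * ((v : ℝ) ^ w * (y₁ ^ (u + v)) ^ (v + w))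
        ≤ b ^ w * e ^ v * B ^ (v + w) * ((v : ℝ) ^ w * (y₁ ^ (u + v)) ^ (v + w)) := by
      calc c ^ (v + w) * (v : ℝ) ^ v * (A ^ w * t₁ ^ v) * ((v : ℝ) ^ w * (y₁ ^ (u + v)) ^ (v + w))
          = ((v : ℝ) * c * y₁ ^ (u + v)) ^ (v + w) * A ^ w * t₁ ^ v := by ring
        _ = (a * B) ^ (v + w) * A ^ w * t₁ ^ v := by rw [hR1]
        _ = (a * A) ^ w * (a * t₁) ^ v * B ^ (v + w) := by ring
        _ ≤ ((v : ℝ) * b * y₁ ^ u) ^ w * (a * t₁) ^ v * B ^ (v + w) := by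
          have : 0 ≤ (a * t₁) ^ v * B ^ (v + w) := by positivity
          calc (a * A) ^ w * (a * t₁) ^ v * B ^ (v + w) = (a * A) ^ w * ((a * t₁) ^ v * B ^ (v + w)) := by ring
            _ ≤ ((v : ℝ) * b * y₁ ^ u) ^ w * ((a * t₁) ^ v * B ^ (v + w)) := mul_le_mul_of_nonneg_right h1 this
            _ = _ := by ring
        _ = ((v : ℝ) * b * y₁ ^ u) ^ w * (e * y₁ ^ (u + v + w)) ^ v * B ^ (v + w) := by rw [ht₁]
        _ = b ^ w * e ^ v * B ^ (v + w) * ((v : ℝ) ^ w * ((y₁ ^ u) ^ w * (y₁ ^ (u + v + w)) ^ v)) := by ring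
        _ = b ^ w * e ^ v * B ^ (v + w) * ((v : ℝ) ^ w * (y₁ ^ (u + v)) ^ (v + w)) := by rw [hsw]
    exact le_of_mul_le_mul_right key hK

/-- **Upper-branch bounds.**  Symmetrically there is an upper-branch parameter `t₂ ≥ t*` (`t₂ = e·y₂^S/a` at the upper critical
point) with `Σ1 ≤ H1(t₂)` and `Σ2 ≥ H2(t₂)`. [folklore] -/
theorem fourNomial_upper_branch_bounds {u v w : ℕ} (hu : 0 < u) (hv : 0 < v) (hw : 0 < w)
    {a b c e : ℝ} (ha : 0 < a) (hb : 0 < b) (hc : 0 < c) (he : 0 < e)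
    (h3 : 3 ≤ (C a - C b * X ^ u + C c * X ^ (u + v) - C e * X ^ (u + v + w) : ℝ[X]).roots.countP (fun x => 0 < x)) :
    ∃ t₂ : ℝ, (u : ℝ) * ((u : ℝ) + v) ≤ (w : ℝ) * ((v : ℝ) + w) * t₂ ∧
      b ^ (u + v) * (v : ℝ) ^ v * ((u : ℝ) + ((v : ℝ) + w) * t₂) ^ u
        ≤ a ^ v * c ^ u * (((u : ℝ) + v) + (w : ℝ) * t₂) ^ (u + v) ∧
      b ^ w * e ^ v * ((u : ℝ) + ((v : ℝ) + w) * t₂) ^ (v + w)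
        ≤ c ^ (v + w) * (v : ℝ) ^ v * ((((u : ℝ) + v) + (w : ℝ) * t₂) ^ w * t₂ ^ v) := by
  obtain ⟨y₁, y₂, hy₁, hy₁₂, -, hΦ₂, -, hg₂, -, hc₂⟩ :=
    fourNomial_exists_twist_zeros_of_three_le_countP hu hv hw ha hc he (b := b) h3
  have hy₂ : 0 < y₂ := hy₁.trans_le hy₁₂
  set t₂ : ℝ := e * y₂ ^ (u + v + w) / a with ht₂def
  have ht₂ : a * t₂ = e * y₂ ^ (u + v + w) := by rw [ht₂def]; field_simp
  have ht₂0 : 0 < t₂ := by rw [ht₂def]; positivity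
  have hR1 : (v : ℝ) * c * y₂ ^ (u + v) = a * ((u : ℝ) + ((v : ℝ) + w) * t₂) := by
    linear_combination (-1 : ℝ) * hΦ₂ - ((v : ℝ) + w) * ht₂
  have hR2 : (v : ℝ) * b * y₂ ^ u ≤ a * (((u : ℝ) + v) + (w : ℝ) * t₂) := by
    linear_combination (v : ℝ) * hg₂ + hR1 + (v : ℝ) * ht₂
  set A : ℝ := ((u : ℝ) + v) + (w : ℝ) * t₂ with hA
  set B : ℝ := (u : ℝ) + ((v : ℝ) + w) * t₂ with hB
  have hA0 : 0 < A := by rw [hA]; positivity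
  have hB0 : 0 < B := by rw [hB]; positivity
  have hX0 : 0 ≤ (v : ℝ) * b * y₂ ^ u := by positivity
  refine ⟨t₂, ?_, ?_, ?_⟩
  · rw [ht₂def, ← mul_div_assoc, le_div_iff₀ ha]; linarith
  · have hK : 0 < (v : ℝ) ^ u * (y₂ ^ (u + v)) ^ u := by positivity
    have hsw : (y₂ ^ (u + v)) ^ u = (y₂ ^ u) ^ (u + v) := by rw [← pow_mul, ← pow_mul, mul_comm]
    have h1 : ((v : ℝ) * b * y₂ ^ u) ^ (u + v) ≤ (a * A) ^ (u + v) := pow_le_pow_left₀ hX0 hR2 _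
    have key : b ^ (u + v) * (v : ℝ) ^ v * B ^ u * ((v : ℝ) ^ u * (y₂ ^ (u + v)) ^ u)
        ≤ a ^ v * c ^ u * A ^ (u + v) * ((v : ℝ) ^ u * (y₂ ^ (u + v)) ^ u) := by
      calc b ^ (u + v) * (v : ℝ) ^ v * B ^ u * ((v : ℝ) ^ u * (y₂ ^ (u + v)) ^ u)
          = ((v : ℝ) * b * y₂ ^ u) ^ (u + v) * B ^ u := by rw [hsw]; ring
        _ ≤ (a * A) ^ (u + v) * B ^ u := mul_le_mul_of_nonneg_right h1 (pow_pos hB0 u).le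
        _ = a ^ v * A ^ (u + v) * (a * B) ^ u := by ring
        _ = a ^ v * A ^ (u + v) * ((v : ℝ) * c * y₂ ^ (u + v)) ^ u := by rw [hR1]
        _ = a ^ v * c ^ u * A ^ (u + v) * ((v : ℝ) ^ u * (y₂ ^ (u + v)) ^ u) := by ring
    exact le_of_mul_le_mul_right key hK
  · have hK : 0 < (v : ℝ) ^ w * (y₂ ^ (u + v)) ^ (v + w) := by positivity
    have hsw : (y₂ ^ (u + v)) ^ (v + w) = (y₂ ^ u) ^ w * (y₂ ^ (u + v + w)) ^ v := by
      rw [← pow_mul, ← pow_mul, ← pow_mul, ← pow_add]; congr 1; ring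
    have h1 : ((v : ℝ) * b * y₂ ^ u) ^ w ≤ (a * A) ^ w := pow_le_pow_left₀ hX0 hR2 _
    have key : b ^ w * e ^ v * B ^ (v + w) * ((v : ℝ) ^ w * (y₂ ^ (u + v)) ^ (v + w))
        ≤ c ^ (v + w) * (v : ℝ) ^ v * (A ^ w * t₂ ^ v) * ((v : ℝ) ^ w * (y₂ ^ (u + v)) ^ (v + w)) := by
      calc b ^ w * e ^ v * B ^ (v + w) * ((v : ℝ) ^ w * (y₂ ^ (u + v)) ^ (v + w))
          = b ^ w * e ^ v * B ^ (v + w) * ((v : ℝ) ^ w * ((y₂ ^ u) ^ w * (y₂ ^ (u + v + w)) ^ v)) := by rw [hsw]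
        _ = ((v : ℝ) * b * y₂ ^ u) ^ w * (e * y₂ ^ (u + v + w)) ^ v * B ^ (v + w) := by ring
        _ = ((v : ℝ) * b * y₂ ^ u) ^ w * ((a * t₂) ^ v * B ^ (v + w)) := by rw [← ht₂]; ring
        _ ≤ (a * A) ^ w * ((a * t₂) ^ v * B ^ (v + w)) := mul_le_mul_of_nonneg_right h1 (by positivity)
        _ = (a * B) ^ (v + w) * A ^ w * t₂ ^ v := by ring
        _ = ((v : ℝ) * c * y₂ ^ (u + v)) ^ (v + w) * A ^ w * t₂ ^ v := by rw [hR1]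
        _ = c ^ (v + w) * (v : ℝ) ^ v * (A ^ w * t₂ ^ v) * ((v : ℝ) ^ w * (y₂ ^ (u + v)) ^ (v + w)) := by ring
    exact le_of_mul_le_mul_right key hK

/-- **POCKET ROW (lower branch, lower-bound transfer)** — `exacttubeq.lower_bound_partner('lo', ·)` in the kernel.
`u, v, w ≥ 1`, `a, b, c, e > 0`, `g = a − bX^u + cX^(u+v) − eX^(u+v+w)` with at least three positive roots counted with
multiplicity; `0 < t` with `w(v+w)·t ≤ u(u+v)` (a LOWER-branch parameter; `t = ρ^S` for the double root `ρ` of the normal form).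
If `Σ2 = c^(v+w)/(b^w e^v) ≥ H2(t)` then `Σ1 = b^(u+v)/(a^v c^u) ≥ H1(t)`; both as product inequalities:
`b^w e^v (u+(v+w)t)^(v+w) ≤ c^(v+w) v^v ((u+v)+wt)^w t^v ⇒ a^v c^u ((u+v)+wt)^(u+v) ≤ b^(u+v) v^v (u+(v+w)t)^u`. [folklore] -/
theorem fourNomial_pocket_lower_of_three_le_countP {u v w : ℕ} (hu : 0 < u) (hv : 0 < v) (hw : 0 < w)
    {a b c e : ℝ} (ha : 0 < a) (hb : 0 < b) (hc : 0 < c) (he : 0 < e)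
    (h3 : 3 ≤ (C a - C b * X ^ u + C c * X ^ (u + v) - C e * X ^ (u + v + w) : ℝ[X]).roots.countP (fun x => 0 < x))
    {t : ℝ} (ht : 0 < t) (hlow : (w : ℝ) * ((v : ℝ) + w) * t ≤ (u : ℝ) * ((u : ℝ) + v))
    (hM : b ^ w * e ^ v * ((u : ℝ) + ((v : ℝ) + w) * t) ^ (v + w)
      ≤ c ^ (v + w) * (v : ℝ) ^ v * ((((u : ℝ) + v) + (w : ℝ) * t) ^ w * t ^ v)) :
    a ^ v * c ^ u * (((u : ℝ) + v) + (w : ℝ) * t) ^ (u + v)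
      ≤ b ^ (u + v) * (v : ℝ) ^ v * ((u : ℝ) + ((v : ℝ) + w) * t) ^ u := by
  obtain ⟨t₁, ht₁, hlow₁, hlo1, hlo2⟩ := fourNomial_lower_branch_bounds hu hv hw ha hc he (b := b) h3
  have hK0 : 0 < c ^ (v + w) * (v : ℝ) ^ v * (b ^ w * e ^ v) := by positivity
  -- `t₁ ≤ t`: otherwise `H2(t₁) < H2(t) ≤ Σ2 ≤ H2(t₁)`
  have ht₁t : t₁ ≤ t := by
    by_contra hlt
    push Not at hlt
    have hs := pocket_H2_lt_lower hu hv hw ht hlt hlow₁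
    have hle := mul_le_mul hlo2 hM (by positivity) (by positivity)
    have key : (c ^ (v + w) * (v : ℝ) ^ v * (b ^ w * e ^ v))
        * (((u : ℝ) + ((v : ℝ) + w) * t) ^ (v + w) * ((((u : ℝ) + v) + (w : ℝ) * t₁) ^ w * t₁ ^ v))
        ≤ (c ^ (v + w) * (v : ℝ) ^ v * (b ^ w * e ^ v))
        * (((u : ℝ) + ((v : ℝ) + w) * t₁) ^ (v + w) * ((((u : ℝ) + v) + (w : ℝ) * t) ^ w * t ^ v)) := by
      calc _ = c ^ (v + w) * (v : ℝ) ^ v * ((((u : ℝ) + v) + (w : ℝ) * t₁) ^ w * t₁ ^ v)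
            * (b ^ w * e ^ v * ((u : ℝ) + ((v : ℝ) + w) * t) ^ (v + w)) := by ring
        _ ≤ _ := hle
        _ = _ := by ring
    have := le_of_mul_le_mul_left key hK0
    linarith
  rcases ht₁t.eq_or_lt with h | h
  · rw [← h]; exact hlo1
  · have hs := pocket_H1_lt_lower hu hv hw ht₁ h hlow
    have hK : 0 < ((u : ℝ) + ((v : ℝ) + w) * t₁) ^ u := by positivity
    have key : a ^ v * c ^ u * (((u : ℝ) + v) + (w : ℝ) * t) ^ (u + v) * ((u : ℝ) + ((v : ℝ) + w) * t₁) ^ u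
        < b ^ (u + v) * (v : ℝ) ^ v * ((u : ℝ) + ((v : ℝ) + w) * t) ^ u * ((u : ℝ) + ((v : ℝ) + w) * t₁) ^ u := by
      calc a ^ v * c ^ u * (((u : ℝ) + v) + (w : ℝ) * t) ^ (u + v) * ((u : ℝ) + ((v : ℝ) + w) * t₁) ^ u
          = a ^ v * c ^ u * ((((u : ℝ) + v) + (w : ℝ) * t) ^ (u + v) * ((u : ℝ) + ((v : ℝ) + w) * t₁) ^ u) := by ring
        _ < a ^ v * c ^ u * ((((u : ℝ) + v) + (w : ℝ) * t₁) ^ (u + v) * ((u : ℝ) + ((v : ℝ) + w) * t) ^ u) :=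
          mul_lt_mul_of_pos_left hs (by positivity)
        _ = a ^ v * c ^ u * (((u : ℝ) + v) + (w : ℝ) * t₁) ^ (u + v) * ((u : ℝ) + ((v : ℝ) + w) * t) ^ u := by ring
        _ ≤ b ^ (u + v) * (v : ℝ) ^ v * ((u : ℝ) + ((v : ℝ) + w) * t₁) ^ u * ((u : ℝ) + ((v : ℝ) + w) * t) ^ u :=
          mul_le_mul_of_nonneg_right hlo1 (by positivity)
        _ = _ := by ring
    exact (lt_of_mul_lt_mul_right key hK.le).le

/-- **POCKET ROW (lower branch, upper-bound transfer)** — `exacttubeq.upper_bound_partner('lo', ·)` in the kernel.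
Same setting, `w(v+w)·t ≤ u(u+v)`.  If `Σ1 ≤ H1(t)` then `Σ2 ≤ H2(t)`:
`b^(u+v) v^v (u+(v+w)t)^u ≤ a^v c^u ((u+v)+wt)^(u+v) ⇒ c^(v+w) v^v ((u+v)+wt)^w t^v ≤ b^w e^v (u+(v+w)t)^(v+w)`. [folklore] -/
theorem fourNomial_pocket_lower_of_three_le_countP' {u v w : ℕ} (hu : 0 < u) (hv : 0 < v) (hw : 0 < w)
    {a b c e : ℝ} (ha : 0 < a) (hb : 0 < b) (hc : 0 < c) (he : 0 < e)
    (h3 : 3 ≤ (C a - C b * X ^ u + C c * X ^ (u + v) - C e * X ^ (u + v + w) : ℝ[X]).roots.countP (fun x => 0 < x))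
    {t : ℝ} (ht : 0 < t) (hlow : (w : ℝ) * ((v : ℝ) + w) * t ≤ (u : ℝ) * ((u : ℝ) + v))
    (hH : b ^ (u + v) * (v : ℝ) ^ v * ((u : ℝ) + ((v : ℝ) + w) * t) ^ u
      ≤ a ^ v * c ^ u * (((u : ℝ) + v) + (w : ℝ) * t) ^ (u + v)) :
    c ^ (v + w) * (v : ℝ) ^ v * ((((u : ℝ) + v) + (w : ℝ) * t) ^ w * t ^ v)
      ≤ b ^ w * e ^ v * ((u : ℝ) + ((v : ℝ) + w) * t) ^ (v + w) := by
  obtain ⟨t₁, ht₁, hlow₁, hlo1, hlo2⟩ := fourNomial_lower_branch_bounds hu hv hw ha hc he (b := b) h3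
  have hK0 : 0 < a ^ v * c ^ u * (b ^ (u + v) * (v : ℝ) ^ v) := by positivity
  -- `t ≤ t₁`: otherwise `H1(t) < H1(t₁) ≤ Σ1 ≤ H1(t)`
  have htt₁ : t ≤ t₁ := by
    by_contra hlt
    push Not at hlt
    have hs := pocket_H1_lt_lower hu hv hw ht₁ hlt hlow
    have hle := mul_le_mul hlo1 hH (by positivity) (by positivity)
    have key : (a ^ v * c ^ u * (b ^ (u + v) * (v : ℝ) ^ v))
        * ((((u : ℝ) + v) + (w : ℝ) * t₁) ^ (u + v) * ((u : ℝ) + ((v : ℝ) + w) * t) ^ u)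
        ≤ (a ^ v * c ^ u * (b ^ (u + v) * (v : ℝ) ^ v))
        * ((((u : ℝ) + v) + (w : ℝ) * t) ^ (u + v) * ((u : ℝ) + ((v : ℝ) + w) * t₁) ^ u) := by
      calc _ = a ^ v * c ^ u * (((u : ℝ) + v) + (w : ℝ) * t₁) ^ (u + v)
            * (b ^ (u + v) * (v : ℝ) ^ v * ((u : ℝ) + ((v : ℝ) + w) * t) ^ u) := by ring
        _ ≤ _ := hle
        _ = _ := by ring
    have := le_of_mul_le_mul_left key hK0
    linarith
  rcases htt₁.eq_or_lt with h | h
  · rw [h]; exact hlo2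
  · have hs := pocket_H2_lt_lower hu hv hw ht h hlow₁
    have hK : 0 < ((u : ℝ) + ((v : ℝ) + w) * t₁) ^ (v + w) := by positivity
    have key : c ^ (v + w) * (v : ℝ) ^ v * ((((u : ℝ) + v) + (w : ℝ) * t) ^ w * t ^ v)
          * ((u : ℝ) + ((v : ℝ) + w) * t₁) ^ (v + w)
        < b ^ w * e ^ v * ((u : ℝ) + ((v : ℝ) + w) * t) ^ (v + w) * ((u : ℝ) + ((v : ℝ) + w) * t₁) ^ (v + w) := by
      calc c ^ (v + w) * (v : ℝ) ^ v * ((((u : ℝ) + v) + (w : ℝ) * t) ^ w * t ^ v) * ((u : ℝ) + ((v : ℝ) + w) * t₁) ^ (v + w)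
          = c ^ (v + w) * (v : ℝ) ^ v
            * (((u : ℝ) + ((v : ℝ) + w) * t₁) ^ (v + w) * ((((u : ℝ) + v) + (w : ℝ) * t) ^ w * t ^ v)) := by ring
        _ < c ^ (v + w) * (v : ℝ) ^ v
            * (((u : ℝ) + ((v : ℝ) + w) * t) ^ (v + w) * ((((u : ℝ) + v) + (w : ℝ) * t₁) ^ w * t₁ ^ v)) :=
          mul_lt_mul_of_pos_left hs (by positivity)
        _ = c ^ (v + w) * (v : ℝ) ^ v * ((((u : ℝ) + v) + (w : ℝ) * t₁) ^ w * t₁ ^ v)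
            * ((u : ℝ) + ((v : ℝ) + w) * t) ^ (v + w) := by ring
        _ ≤ b ^ w * e ^ v * ((u : ℝ) + ((v : ℝ) + w) * t₁) ^ (v + w) * ((u : ℝ) + ((v : ℝ) + w) * t) ^ (v + w) :=
          mul_le_mul_of_nonneg_right hlo2 (by positivity)
        _ = _ := by ring
    exact (lt_of_mul_lt_mul_right key hK.le).le

/-- **POCKET ROW (upper branch, lower-bound transfer)** — `exacttubeq.lower_bound_partner('up', ·)` in the kernel.
`u(u+v) ≤ w(v+w)·t` (an UPPER-branch parameter).  If `Σ1 ≥ H1(t)` then `Σ2 ≥ H2(t)`: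
`a^v c^u ((u+v)+wt)^(u+v) ≤ b^(u+v) v^v (u+(v+w)t)^u ⇒ b^w e^v (u+(v+w)t)^(v+w) ≤ c^(v+w) v^v ((u+v)+wt)^w t^v`. [folklore] -/
theorem fourNomial_pocket_upper_of_three_le_countP {u v w : ℕ} (hu : 0 < u) (hv : 0 < v) (hw : 0 < w)
    {a b c e : ℝ} (ha : 0 < a) (hb : 0 < b) (hc : 0 < c) (he : 0 < e)
    (h3 : 3 ≤ (C a - C b * X ^ u + C c * X ^ (u + v) - C e * X ^ (u + v + w) : ℝ[X]).roots.countP (fun x => 0 < x))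
    {t : ℝ} (hup : (u : ℝ) * ((u : ℝ) + v) ≤ (w : ℝ) * ((v : ℝ) + w) * t)
    (hM : a ^ v * c ^ u * (((u : ℝ) + v) + (w : ℝ) * t) ^ (u + v)
      ≤ b ^ (u + v) * (v : ℝ) ^ v * ((u : ℝ) + ((v : ℝ) + w) * t) ^ u) :
    b ^ w * e ^ v * ((u : ℝ) + ((v : ℝ) + w) * t) ^ (v + w)
      ≤ c ^ (v + w) * (v : ℝ) ^ v * ((((u : ℝ) + v) + (w : ℝ) * t) ^ w * t ^ v) := by
  obtain ⟨t₂, hup₂, hup1, hup2⟩ := fourNomial_upper_branch_bounds hu hv hw ha hb hc he h3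
  have ht : 0 < t := lt_of_lt_of_le (by positivity) ((div_le_iff₀ (by positivity)).mpr (by linarith [hup]) :
    (u : ℝ) * ((u : ℝ) + v) / ((w : ℝ) * ((v : ℝ) + w)) ≤ t)
  have ht₂ : 0 < t₂ := lt_of_lt_of_le (by positivity) ((div_le_iff₀ (by positivity)).mpr (by linarith [hup₂]) :
    (u : ℝ) * ((u : ℝ) + v) / ((w : ℝ) * ((v : ℝ) + w)) ≤ t₂)
  have hK0 : 0 < a ^ v * c ^ u * (b ^ (u + v) * (v : ℝ) ^ v) := by positivity
  -- `t ≤ t₂`: otherwise `H1(t₂) < H1(t) ≤ Σ1 ≤ H1(t₂)`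
  have htt₂ : t ≤ t₂ := by
    by_contra hlt
    push Not at hlt
    have hs := pocket_H1_lt_upper hu hv hw hup₂ hlt
    have hle := mul_le_mul hup1 hM (by positivity) (by positivity)
    have key : (a ^ v * c ^ u * (b ^ (u + v) * (v : ℝ) ^ v))
        * ((((u : ℝ) + v) + (w : ℝ) * t) ^ (u + v) * ((u : ℝ) + ((v : ℝ) + w) * t₂) ^ u)
        ≤ (a ^ v * c ^ u * (b ^ (u + v) * (v : ℝ) ^ v))
        * ((((u : ℝ) + v) + (w : ℝ) * t₂) ^ (u + v) * ((u : ℝ) + ((v : ℝ) + w) * t) ^ u) := by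
      calc _ = b ^ (u + v) * (v : ℝ) ^ v * ((u : ℝ) + ((v : ℝ) + w) * t₂) ^ u
            * (a ^ v * c ^ u * (((u : ℝ) + v) + (w : ℝ) * t) ^ (u + v)) := by ring
        _ ≤ _ := hle
        _ = _ := by ring
    have := le_of_mul_le_mul_left key hK0
    linarith
  rcases htt₂.eq_or_lt with h | h
  · rw [h]; exact hup2
  · have hs := pocket_H2_lt_upper hu hv hw hup h
    have hK : 0 < (((u : ℝ) + v) + (w : ℝ) * t₂) ^ w * t₂ ^ v := by positivity
    have key : b ^ w * e ^ v * ((u : ℝ) + ((v : ℝ) + w) * t) ^ (v + w) * ((((u : ℝ) + v) + (w : ℝ) * t₂) ^ w * t₂ ^ v)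
        < c ^ (v + w) * (v : ℝ) ^ v * ((((u : ℝ) + v) + (w : ℝ) * t) ^ w * t ^ v)
          * ((((u : ℝ) + v) + (w : ℝ) * t₂) ^ w * t₂ ^ v) := by
      calc b ^ w * e ^ v * ((u : ℝ) + ((v : ℝ) + w) * t) ^ (v + w) * ((((u : ℝ) + v) + (w : ℝ) * t₂) ^ w * t₂ ^ v)
          = b ^ w * e ^ v * (((u : ℝ) + ((v : ℝ) + w) * t) ^ (v + w) * ((((u : ℝ) + v) + (w : ℝ) * t₂) ^ w * t₂ ^ v)) := by
            ring
        _ < b ^ w * e ^ v * (((u : ℝ) + ((v : ℝ) + w) * t₂) ^ (v + w) * ((((u : ℝ) + v) + (w : ℝ) * t) ^ w * t ^ v)) :=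
          mul_lt_mul_of_pos_left hs (by positivity)
        _ = b ^ w * e ^ v * ((u : ℝ) + ((v : ℝ) + w) * t₂) ^ (v + w) * ((((u : ℝ) + v) + (w : ℝ) * t) ^ w * t ^ v) := by
            ring
        _ ≤ c ^ (v + w) * (v : ℝ) ^ v * ((((u : ℝ) + v) + (w : ℝ) * t₂) ^ w * t₂ ^ v)
            * ((((u : ℝ) + v) + (w : ℝ) * t) ^ w * t ^ v) := mul_le_mul_of_nonneg_right hup2 (by positivity)
        _ = _ := by ring
    exact (lt_of_mul_lt_mul_right key hK.le).le

/-- **POCKET ROW (upper branch, upper-bound transfer)** — `exacttubeq.upper_bound_partner('up', ·)` in the kernel.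
`u(u+v) ≤ w(v+w)·t`.  If `Σ2 ≤ H2(t)` then `Σ1 ≤ H1(t)`:
`c^(v+w) v^v ((u+v)+wt)^w t^v ≤ b^w e^v (u+(v+w)t)^(v+w) ⇒ b^(u+v) v^v (u+(v+w)t)^u ≤ a^v c^u ((u+v)+wt)^(u+v)`. [folklore] -/
theorem fourNomial_pocket_upper_of_three_le_countP' {u v w : ℕ} (hu : 0 < u) (hv : 0 < v) (hw : 0 < w)
    {a b c e : ℝ} (ha : 0 < a) (hb : 0 < b) (hc : 0 < c) (he : 0 < e)
    (h3 : 3 ≤ (C a - C b * X ^ u + C c * X ^ (u + v) - C e * X ^ (u + v + w) : ℝ[X]).roots.countP (fun x => 0 < x))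
    {t : ℝ} (hup : (u : ℝ) * ((u : ℝ) + v) ≤ (w : ℝ) * ((v : ℝ) + w) * t)
    (hH : c ^ (v + w) * (v : ℝ) ^ v * ((((u : ℝ) + v) + (w : ℝ) * t) ^ w * t ^ v)
      ≤ b ^ w * e ^ v * ((u : ℝ) + ((v : ℝ) + w) * t) ^ (v + w)) :
    b ^ (u + v) * (v : ℝ) ^ v * ((u : ℝ) + ((v : ℝ) + w) * t) ^ u
      ≤ a ^ v * c ^ u * (((u : ℝ) + v) + (w : ℝ) * t) ^ (u + v) := by
  obtain ⟨t₂, hup₂, hup1, hup2⟩ := fourNomial_upper_branch_bounds hu hv hw ha hb hc he h3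
  have ht : 0 < t := lt_of_lt_of_le (by positivity) ((div_le_iff₀ (by positivity)).mpr (by linarith [hup]) :
    (u : ℝ) * ((u : ℝ) + v) / ((w : ℝ) * ((v : ℝ) + w)) ≤ t)
  have ht₂ : 0 < t₂ := lt_of_lt_of_le (by positivity) ((div_le_iff₀ (by positivity)).mpr (by linarith [hup₂]) :
    (u : ℝ) * ((u : ℝ) + v) / ((w : ℝ) * ((v : ℝ) + w)) ≤ t₂)
  have hK0 : 0 < c ^ (v + w) * (v : ℝ) ^ v * (b ^ w * e ^ v) := by positivity
  -- `t₂ ≤ t`: otherwise `H2(t) < H2(t₂) ≤ Σ2 ≤ H2(t)`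
  have ht₂t : t₂ ≤ t := by
    by_contra hlt
    push Not at hlt
    have hs := pocket_H2_lt_upper hu hv hw hup hlt
    have hle := mul_le_mul hup2 hH (by positivity) (by positivity)
    have key : (c ^ (v + w) * (v : ℝ) ^ v * (b ^ w * e ^ v))
        * (((u : ℝ) + ((v : ℝ) + w) * t₂) ^ (v + w) * ((((u : ℝ) + v) + (w : ℝ) * t) ^ w * t ^ v))
        ≤ (c ^ (v + w) * (v : ℝ) ^ v * (b ^ w * e ^ v))
        * (((u : ℝ) + ((v : ℝ) + w) * t) ^ (v + w) * ((((u : ℝ) + v) + (w : ℝ) * t₂) ^ w * t₂ ^ v)) := by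
      calc _ = b ^ w * e ^ v * ((u : ℝ) + ((v : ℝ) + w) * t₂) ^ (v + w)
            * (c ^ (v + w) * (v : ℝ) ^ v * ((((u : ℝ) + v) + (w : ℝ) * t) ^ w * t ^ v)) := by ring
        _ ≤ _ := hle
        _ = _ := by ring
    have := le_of_mul_le_mul_left key hK0
    linarith
  rcases ht₂t.eq_or_lt with h | h
  · rw [← h]; exact hup1
  · have hs := pocket_H1_lt_upper hu hv hw hup₂ h
    have hK : 0 < (((u : ℝ) + v) + (w : ℝ) * t₂) ^ (u + v) := by positivity
    have key : b ^ (u + v) * (v : ℝ) ^ v * ((u : ℝ) + ((v : ℝ) + w) * t) ^ u * (((u : ℝ) + v) + (w : ℝ) * t₂) ^ (u + v)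
        < a ^ v * c ^ u * (((u : ℝ) + v) + (w : ℝ) * t) ^ (u + v) * (((u : ℝ) + v) + (w : ℝ) * t₂) ^ (u + v) := by
      calc b ^ (u + v) * (v : ℝ) ^ v * ((u : ℝ) + ((v : ℝ) + w) * t) ^ u * (((u : ℝ) + v) + (w : ℝ) * t₂) ^ (u + v)
          = b ^ (u + v) * (v : ℝ) ^ v * ((((u : ℝ) + v) + (w : ℝ) * t₂) ^ (u + v) * ((u : ℝ) + ((v : ℝ) + w) * t) ^ u) := by
            ring
        _ < b ^ (u + v) * (v : ℝ) ^ v * ((((u : ℝ) + v) + (w : ℝ) * t) ^ (u + v) * ((u : ℝ) + ((v : ℝ) + w) * t₂) ^ u) :=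
          mul_lt_mul_of_pos_left hs (by positivity)
        _ = b ^ (u + v) * (v : ℝ) ^ v * ((u : ℝ) + ((v : ℝ) + w) * t₂) ^ u * (((u : ℝ) + v) + (w : ℝ) * t) ^ (u + v) := by
            ring
        _ ≤ a ^ v * c ^ u * (((u : ℝ) + v) + (w : ℝ) * t₂) ^ (u + v) * (((u : ℝ) + v) + (w : ℝ) * t) ^ (u + v) :=
          mul_le_mul_of_nonneg_right hup1 (by positivity)
        _ = _ := by ring
    exact (lt_of_mul_lt_mul_right key hK.le).le

end Summit.ValiantsHypothesis.ValiantsHypothesis.Theorems.LacunarySymmetroidMatrixDescartes.Census
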